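import Mathlib

/-!
# The polynomial certificate of (★) — the gate-free inequality of the general gate of the six-cell (XA′)
(blind cell PercRepro2, night-2 g28; proofs/NIGHT2-DARC.md §69)

(★): `(o_u + a₀u)·r₁u·Ũ ≥ A·a2·a₀u·[(o_u + a₀u)·r₁u − a₁u·(b_u + r₀u)]`, `Ũ = a0·Ā·r₁u − a0·A·a₁u − A·a2·|Q|` the
open-gate functional, in the cell masses of the laws `νc`, `νd` on the six cells (`I₀, D′₀, D′₁, D″, D*₀, D*₁`):
20 products of 14 set-level Ahlswede–Daykin slacks on unions of cells (meets computed for an ARBITRARY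
coin-entered set), the cellwise order slacks `d ≤ c` and monomials sum to the difference (`xa_star_ET`, pure algebra),
each product is nonnegative under the facts (`xa_star_S`), hence (★) (`xa_star_cert`).  Found by LP (kit), rationalised
exactly in Fractions.  The bridge to the chain data is in CoinChainXAStarFacts.lean.
-/

namespace Summit.Ventures.PercRepro2.Coin

open Classical

section StarCert

variable {R : Type*} [Field R] [LinearOrder R] [IsStrictOrderedRing R]

omit [LinearOrder R] [IsStrictOrderedRing R] in
set_option maxHeartbeats 1600000 in
/-- The difference of the two sides of (★) as the positive combination of the 20 products (pure algebra). -/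
lemma xa_star_ET (o a₀ a₁ b r₀ _r₁ ou a₀u a₁u bu r₀u r₁u : R) :
    (ou + a₀u) * r₁u * ((o + a₀ + a₁ + bu + r₀u + r₁u) * (o + a₀ + a₁) * r₁u - (o + a₀ + a₁ + bu + r₀u + r₁u) * (bu + r₀u + r₁u) * a₁u - (bu + r₀u + r₁u) * (a₁ + r₁u) * (a₀ + a₁ - a₀u - a₁u)) - (bu + r₀u + r₁u) * (a₁ + r₁u) * a₀u * ((ou + a₀u) * r₁u - a₁u * (bu + r₀u)) = ((o * a₀u - ou * a₀) * ((bu + (r₀u)) * r₁u - r₀u * r₁u) * (a₁)) + (((o + (a₀)) * r₁u - a₀ * r₁u) * ((ou + (a₀u)) * r₁u - a₁u * (bu + (r₀u))) * (r₁u)) + (((ou + (a₀u)) * r₁u - a₀u * r₁u) * ((o + (a₀)) * r₁u - a₁u * (b + (r₀))) * (a₀)) + (((o + (a₀)) * r₁u - a₁ * (bu + (r₀u))) * ((o + (a₀)) * r₁u - a₁ * (bu + (r₀u))) * (a₀u)) + (((o + (a₀)) * r₁u - a₁ * (bu + (r₀u))) * ((o + (a₁)) * (a₁u + (bu + (r₁u)))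 - (o + (a₁)) * (a₁u + (bu))) * (ou)) + (((ou + (a₀u)) * r₁u - a₁u * (bu + (r₀u))) * ((ou + (a₀u + (bu))) * (bu + (r₀u)) - (a₀u + (bu)) * (bu + (r₀u))) * (r₁u)) + ((o * a₀u - ou * a₀) * (a₁u * r₁u ^ 2)) + ((o * a₀u - ou * a₀) * (a₁ * r₀u * r₁u)) + (((ou + (a₀u)) * a₁u - a₀u * a₁u) * (b - bu) * (a₀ * r₁u)) + (((ou + (a₀u)) * a₁u - a₀u * a₁u) * (r₀ - r₀u) * (a₀ * r₁u)) + (((o + (a₀)) * r₁u - a₀ * r₁u) * (a₁ - a₁u) * (ou * r₀u)) + ((o * r₁u - a₁ * bu) * (a₁ - a₁u) * (a₀u * r₁u)) + (((o + (a₀)) * r₁u - a₁ * r₀u) * (a₁ - a₁u) * (a₀u * r₁u)) + (((o + (a₀)) * r₁u - a₁ * (bu + (r₀u))) * (a₁ - a₁u) * (a₀u * r₀u)) + (((o + (a₀)) * r₁u - a₁ * (bu + (r₀u))) * (a₁ - a₁u) * (a₀u * bu)) + (((bu + (r₀u)) * r₁u - r₀u * r₁u) * (o - ou) * (a₀u *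 r₁u)) + (((ou + (a₁u)) * (a₁u + (bu + (r₁u))) - (ou + (a₁u)) * (a₁u + (bu))) * (o - ou) * (r₀u * r₁u)) + (((ou + (a₁u)) * (a₁u + (bu + (r₁u))) - (ou + (a₁u)) * (a₁u + (bu))) * (o - ou) * (bu * r₁u)) + (((o + (a₁ + (b))) * (bu + (r₁u)) - (a₁ + (b)) * (bu + (r₁u))) * (a₁ - a₁u) * (ou * r₁u)) + ((o - ou) * a₀u * (r₀u * r₁u ^ 2)) := by
  ring

set_option maxHeartbeats 1600000 in
/-- The 20 products of the certificate are nonnegative (given the set-level facts). -/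
lemma xa_star_S (o a₀ a₁ b r₀ r₁ ou a₀u a₁u bu r₀u r₁u : R)
    (_ho : 0 ≤ o) (ha₀ : 0 ≤ a₀) (ha₁ : 0 ≤ a₁) (_hb : 0 ≤ b) (_hr₀ : 0 ≤ r₀) (_hr₁ : 0 ≤ r₁) (hou : 0 ≤ ou) (ha₀u : 0 ≤ a₀u) (ha₁u : 0 ≤ a₁u) (hbu : 0 ≤ bu) (hr₀u : 0 ≤ r₀u) (hr₁u : 0 ≤ r₁u)
    (hord_I0 : ou ≤ o) (_hord_Dp0 : a₀u ≤ a₀) (hord_Dp1 : a₁u ≤ a₁) (hord_Dpp : bu ≤ b) (hord_Dst0 : r₀u ≤ r₀) (_hord_Dst1 : r₁u ≤ r₁)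
    (f0 : ou * a₀ ≤ o * a₀u)
    (f1 : r₀u * r₁u ≤ (bu + (r₀u)) * r₁u)
    (f2 : a₀ * r₁u ≤ (o + (a₀)) * r₁u)
    (f3 : a₁u * (bu + (r₀u)) ≤ (ou + (a₀u)) * r₁u)
    (f4 : a₀u * r₁u ≤ (ou + (a₀u)) * r₁u)
    (f5 : a₁u * (b + (r₀)) ≤ (o + (a₀)) * r₁u)
    (f6 : a₁ * (bu + (r₀u)) ≤ (o + (a₀)) * r₁u)
    (f7 : (o + (a₁)) * (a₁u + (bu)) ≤ (o + (a₁)) * (a₁u + (bu + (r₁u))))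
    (f8 : (a₀u + (bu)) * (bu + (r₀u)) ≤ (ou + (a₀u + (bu))) * (bu + (r₀u)))
    (f9 : a₀u * a₁u ≤ (ou + (a₀u)) * a₁u)
    (f10 : a₁ * bu ≤ o * r₁u)
    (f11 : a₁ * r₀u ≤ (o + (a₀)) * r₁u)
    (f12 : (ou + (a₁u)) * (a₁u + (bu)) ≤ (ou + (a₁u)) * (a₁u + (bu + (r₁u))))
    (f13 : (a₁ + (b)) * (bu + (r₁u)) ≤ (o + (a₁ + (b))) * (bu + (r₁u))) :
    0 ≤ ((o * a₀u - ou * a₀) * ((bu + (r₀u)) * r₁u - r₀u * r₁u) * (a₁)) + (((o + (a₀)) * r₁u - a₀ * r₁u) * ((ou + (a₀u)) * r₁u - a₁u * (bu + (r₀u))) * (r₁u)) + (((ou + (a₀u)) * r₁u - a₀u * r₁u) * ((o + (a₀)) * r₁u - a₁u * (b + (r₀))) * (a₀)) + (((o + (a₀)) * r₁u - a₁ * (bu + (r₀u))) * ((o + (a₀)) * r₁u - a₁ * (bu + (r₀u))) * (a₀u)) + (((o + (a₀)) * r₁u - a₁ * (bu + (r₀u))) * ((o + (a₁)) * (a₁u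 + (bu + (r₁u))) - (o + (a₁)) * (a₁u + (bu))) * (ou)) + (((ou + (a₀u)) * r₁u - a₁u * (bu + (r₀u))) * ((ou + (a₀u + (bu))) * (bu + (r₀u)) - (a₀u + (bu)) * (bu + (r₀u))) * (r₁u)) + ((o * a₀u - ou * a₀) * (a₁u * r₁u ^ 2)) + ((o * a₀u - ou * a₀) * (a₁ * r₀u * r₁u)) + (((ou + (a₀u)) * a₁u - a₀u * a₁u) * (b - bu) * (a₀ * r₁u)) + (((ou + (a₀u)) * a₁u - a₀u * a₁u) * (r₀ - r₀u) * (a₀ * r₁u)) + (((o + (a₀)) * r₁u - a₀ * r₁u) * (a₁ - a₁u) * (ou * r₀u)) + ((o * r₁u - a₁ * bu) * (a₁ - a₁u) * (a₀u * r₁u)) + (((o + (a₀)) * r₁u - a₁ * r₀u) * (a₁ - a₁u) * (a₀u * r₁u)) + (((o + (a₀)) * r₁u - a₁ * (bu + (r₀u))) * (a₁ - a₁u) * (a₀u * r₀u)) + (((o + (a₀)) * r₁u - a₁ * (bu + (r₀u))) * (a₁ - a₁u) * (a₀u * bu)) + (((bu + (r₀u)) * r₁u - r₀u * r₁u) * (o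 - ou) * (a₀u * r₁u)) + (((ou + (a₁u)) * (a₁u + (bu + (r₁u))) - (ou + (a₁u)) * (a₁u + (bu))) * (o - ou) * (r₀u * r₁u)) + (((ou + (a₁u)) * (a₁u + (bu + (r₁u))) - (ou + (a₁u)) * (a₁u + (bu))) * (o - ou) * (bu * r₁u)) + (((o + (a₁ + (b))) * (bu + (r₁u)) - (a₁ + (b)) * (bu + (r₁u))) * (a₁ - a₁u) * (ou * r₁u)) + ((o - ou) * a₀u * (r₀u * r₁u ^ 2)) := by
  have H0 := mul_nonneg (mul_nonneg (sub_nonneg.2 f0) (sub_nonneg.2 f1)) (by positivity : (0:R) ≤ a₁)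
  have H1 := mul_nonneg (mul_nonneg (sub_nonneg.2 f2) (sub_nonneg.2 f3)) (by positivity : (0:R) ≤ r₁u)
  have H2 := mul_nonneg (mul_nonneg (sub_nonneg.2 f4) (sub_nonneg.2 f5)) (by positivity : (0:R) ≤ a₀)
  have H3 := mul_nonneg (mul_nonneg (sub_nonneg.2 f6) (sub_nonneg.2 f6)) (by positivity : (0:R) ≤ a₀u)
  have H4 := mul_nonneg (mul_nonneg (sub_nonneg.2 f6) (sub_nonneg.2 f7)) (by positivity : (0:R) ≤ ou)
  have H5 := mul_nonneg (mul_nonneg (sub_nonneg.2 f3) (sub_nonneg.2 f8)) (by positivity : (0:R) ≤ r₁u)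
  have H6 := mul_nonneg (sub_nonneg.2 f0) (by positivity : (0:R) ≤ a₁u * r₁u ^ 2)
  have H7 := mul_nonneg (sub_nonneg.2 f0) (by positivity : (0:R) ≤ a₁ * r₀u * r₁u)
  have H8 := mul_nonneg (mul_nonneg (sub_nonneg.2 f9) (sub_nonneg.2 hord_Dpp)) (by positivity : (0:R) ≤ a₀ * r₁u)
  have H9 := mul_nonneg (mul_nonneg (sub_nonneg.2 f9) (sub_nonneg.2 hord_Dst0)) (by positivity : (0:R) ≤ a₀ * r₁u)
  have H10 := mul_nonneg (mul_nonneg (sub_nonneg.2 f2) (sub_nonneg.2 hord_Dp1)) (by positivity : (0:R) ≤ ou * r₀u)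
  have H11 := mul_nonneg (mul_nonneg (sub_nonneg.2 f10) (sub_nonneg.2 hord_Dp1)) (by positivity : (0:R) ≤ a₀u * r₁u)
  have H12 := mul_nonneg (mul_nonneg (sub_nonneg.2 f11) (sub_nonneg.2 hord_Dp1)) (by positivity : (0:R) ≤ a₀u * r₁u)
  have H13 := mul_nonneg (mul_nonneg (sub_nonneg.2 f6) (sub_nonneg.2 hord_Dp1)) (by positivity : (0:R) ≤ a₀u * r₀u)
  have H14 := mul_nonneg (mul_nonneg (sub_nonneg.2 f6) (sub_nonneg.2 hord_Dp1)) (by positivity : (0:R) ≤ a₀u * bu)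
  have H15 := mul_nonneg (mul_nonneg (sub_nonneg.2 f1) (sub_nonneg.2 hord_I0)) (by positivity : (0:R) ≤ a₀u * r₁u)
  have H16 := mul_nonneg (mul_nonneg (sub_nonneg.2 f12) (sub_nonneg.2 hord_I0)) (by positivity : (0:R) ≤ r₀u * r₁u)
  have H17 := mul_nonneg (mul_nonneg (sub_nonneg.2 f12) (sub_nonneg.2 hord_I0)) (by positivity : (0:R) ≤ bu * r₁u)
  have H18 := mul_nonneg (mul_nonneg (sub_nonneg.2 f13) (sub_nonneg.2 hord_Dp1)) (by positivity : (0:R) ≤ ou * r₁u)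
  have H19 := mul_nonneg (mul_nonneg (sub_nonneg.2 hord_I0) (by positivity : (0:R) ≤ a₀u)) (by positivity : (0:R) ≤ r₀u * r₁u ^ 2)
  exact add_nonneg (add_nonneg (add_nonneg (add_nonneg (add_nonneg (add_nonneg (add_nonneg (add_nonneg (add_nonneg (add_nonneg (add_nonneg (add_nonneg (add_nonneg (add_nonneg (add_nonneg (add_nonneg (add_nonneg (add_nonneg (add_nonneg (H0) (H1)) (H2)) (H3)) (H4)) (H5)) (H6)) (H7)) (H8)) (H9)) (H10)) (H11)) (H12)) (H13)) (H14)) (H15)) (H16)) (H17)) (H18)) (H19)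

set_option maxHeartbeats 1600000 in
/-- **THE CERTIFICATE OF (★)**: 20 products of 14 set-level Ahlswede–Daykin slacks (hypotheses
`f0` … `f13`), the cellwise order slacks `d ≤ c` and monomials. -/
theorem xa_star_cert (o a₀ a₁ b r₀ r₁ ou a₀u a₁u bu r₀u r₁u : R)
    (ho : 0 ≤ o) (ha₀ : 0 ≤ a₀) (ha₁ : 0 ≤ a₁) (hb : 0 ≤ b) (hr₀ : 0 ≤ r₀) (hr₁ : 0 ≤ r₁) (hou : 0 ≤ ou) (ha₀u : 0 ≤ a₀u) (ha₁u : 0 ≤ a₁u) (hbu : 0 ≤ bu) (hr₀u : 0 ≤ r₀u) (hr₁u : 0 ≤ r₁u)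
    (hord_I0 : ou ≤ o) (hord_Dp0 : a₀u ≤ a₀) (hord_Dp1 : a₁u ≤ a₁) (hord_Dpp : bu ≤ b) (hord_Dst0 : r₀u ≤ r₀) (hord_Dst1 : r₁u ≤ r₁)
    (f0 : ou * a₀ ≤ o * a₀u)
    (f1 : r₀u * r₁u ≤ (bu + (r₀u)) * r₁u)
    (f2 : a₀ * r₁u ≤ (o + (a₀)) * r₁u)
    (f3 : a₁u * (bu + (r₀u)) ≤ (ou + (a₀u)) * r₁u)
    (f4 : a₀u * r₁u ≤ (ou + (a₀u)) * r₁u)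
    (f5 : a₁u * (b + (r₀)) ≤ (o + (a₀)) * r₁u)
    (f6 : a₁ * (bu + (r₀u)) ≤ (o + (a₀)) * r₁u)
    (f7 : (o + (a₁)) * (a₁u + (bu)) ≤ (o + (a₁)) * (a₁u + (bu + (r₁u))))
    (f8 : (a₀u + (bu)) * (bu + (r₀u)) ≤ (ou + (a₀u + (bu))) * (bu + (r₀u)))
    (f9 : a₀u * a₁u ≤ (ou + (a₀u)) * a₁u)
    (f10 : a₁ * bu ≤ o * r₁u)
    (f11 : a₁ * r₀u ≤ (o + (a₀)) * r₁u)
    (f12 : (ou + (a₁u)) * (a₁u + (bu)) ≤ (ou + (a₁u)) * (a₁u + (bu + (r₁u))))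
    (f13 : (a₁ + (b)) * (bu + (r₁u)) ≤ (o + (a₁ + (b))) * (bu + (r₁u))) :
    (bu + r₀u + r₁u) * (a₁ + r₁u) * a₀u * ((ou + a₀u) * r₁u - a₁u * (bu + r₀u)) ≤ (ou + a₀u) * r₁u * ((o + a₀ + a₁ + bu + r₀u + r₁u) * (o + a₀ + a₁) * r₁u - (o + a₀ + a₁ + bu + r₀u + r₁u) * (bu + r₀u + r₁u) * a₁u - (bu + r₀u + r₁u) * (a₁ + r₁u) * (a₀ + a₁ - a₀u - a₁u)) := by
  rw [← sub_nonneg, xa_star_ET o a₀ a₁ b r₀ r₁ ou a₀u a₁u bu r₀u r₁u]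
  exact xa_star_S o a₀ a₁ b r₀ r₁ ou a₀u a₁u bu r₀u r₁u ho ha₀ ha₁ hb hr₀ hr₁ hou ha₀u ha₁u hbu hr₀u hr₁u hord_I0 hord_Dp0 hord_Dp1 hord_Dpp hord_Dst0 hord_Dst1 f0 f1 f2 f3 f4 f5 f6 f7 f8 f9 f10 f11 f12 f13

end StarCert

end Summit.Ventures.PercRepro2.Coin
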